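import Summits.QuantumFields.YangMills.Theorems.BalabanUVNodesN15KingModelBlockFieldTimeSlices
import Mathlib.Algebra.Field.GeomSum
import Mathlib.Algebra.BigOperators.Fin
import HarnessLib

/-!
# BalabanUVNodes ∕ N15 — THE KING-MODEL RUNG (PART Ϲ-d′): THE ZERO-MOMENTUM TIMESLICE CORRELATOR OF KING's RG BLOCK-FIELD LAW
# `dμ^{(K)} = N(0,(Δ^{(K)})⁻¹)` IS A PURE cosh IN BLOCK TIME WITH MASS `N·ω₀ = 2N·arsinh(√m²∕(2N))` — THE BLOCK-SPIN RG GENERATES NO NEW SCALE;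
# ITS `N → ∞` LIMIT IS THE `K = ∞` GAP `√m²`
# (Track A, DAG node N15 = NE2; FAN-OUT v1.1 §N15 s3 «KING-MODEL RUNG … NE2's analogue DECIDED in the model»; count-neutral)

HONEST FRAMING.  Count-neutral (cell `pub-ymgap`, seat `pub-ymgap-dag-n15-e` g38; `--supports stmt-QuantumFields-27366 --as helper` = K3⁸).
TEMPLATE LITERATURE: C. King, Commun. Math. Phys. **102** (1986) 649–677 [King1986] — King's OWN `A = 0` RG block-field covariance `(Δ^{(K)})⁻¹`
((2.13)–(2.14) p.653, (4.5) p.670); the transfer-matrix reading of Montvay–Münster [MontvayMunster1994] §2.1.2 (2.49) and the free-field energy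
(2.74)–(2.78), physical mass `m̄₀ = m₀{1 + O(a²m₀²)}` (2.82).  PART Ϲ-d (`timeSlice_blockCov_eq_sum`) wrote the block field's zero-momentum
timeslice correlator as noise at coincidence plus `N^{−3}Σ_{i,i′<N} g(N·val s + i − i′)` with the fine cycle resolvent `g`.  THIS FILE evaluates the
double block sum for `s ≠ 0` by PART Ϲ-a′'s image form: two geometric series, in closed form `(sinh(Nω₀∕2)∕sinh(ω₀∕2))²`, times a pure `cosh` in
BLOCK time with mass `N·ω₀` per block — EXACTLY the fine field's lattice mass in block units (Gaussian: the block spin creates no new scale),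
converging (PART Ϲ-c `kingGap_eta_rate`) to the `K = ∞` block field's exact gap `√m²` (this seat's PART Ͳ `king_massGap_eq`) at rate `N^{−2}`.
NOT Bałaban's covariant objects; NOT a node discharge (N15 is booked through n15-a's knit, untouched); no transfer operator is constructed; nothing
continuum-YM ∕ ℝ⁴ ∕ OS axioms ∕ Clay.  0 `sorry`, 0 `def`.

WHAT THIS FILE PROVES (kernel).  §3 `val_slab_sub` (no wrap-around for `s ≠ 0`), `exp_slab_direct ∕ _image` (exponent bookkeeping),
★ `geomProd_eq_sinh_sq` (`(Σ_{i<N} e^{−ωi})(Σ_{i<N} e^{ωi}) = (sinh(Nω∕2)∕sinh(ω∕2))²`).  §4 ★★★ **`timeSlice_blockCov_eq_cosh`** (for `s ≠ 0`: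
`Σ_{b_κ = s} (Δ^{(K)})⁻¹(b,0) = N^{−3}·P∕(2 sinh ω₀(1 − e^{−ω₀NM_κ}))·(e^{−Nω₀·val s} + e^{−Nω₀(M_κ − val s)})`, `P` the geometric product),
★★★ **`timeSlice_blockCov_eq_cosh'`** (the same with `P = (sinh(Nω₀∕2)∕sinh(ω₀∕2))²` — THE RG BLOCK FIELD's TIMESLICE CORRELATOR IS A PURE cosh IN
BLOCK TIME WITH MASS `N·ω₀ = 2N·arsinh(√m²∕2N)` AT EVERY LEVEL), ★★ `timeSlice_blockCov_pos` (strict positivity for `s ≠ 0`); the η-RATE of the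
mass is PART Ϲ-c's `kingGap_eta_rate` verbatim (`0 ≤ √m² − N·ω₀ ≤ (√m²)³∕(24N²)`).

HONEST SCOPE.  King's `A = 0` free model; `s ≠ 0` (at `s = 0` the white noise `a⁻¹` and the intra-block double average add a contact term);
zero spatial momentum only.  N15 untouched; counts unmoved.
Locators: [King1986] (2.13)–(2.14) p.653, (4.5) p.670, (4.44) p.675; [MontvayMunster1994] §2.1.2 (2.49), §2.2.1 (2.74)–(2.82); [DrouffeZuber1983] (3.43)–(3.46) p.41.
-/

noncomputable section

open scoped BigOperators
open Finset Matrix Real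

namespace Summit.QuantumFields.YangMills.BalabanUVNodes.N15KingModelRung.TorusSpectral

open Literature.MathematicalPhysics.QuantumFieldTheory.Balaban1983to89.B5Prop11Plancherel (Tor fine)
open Literature.MathematicalPhysics.QuantumFieldTheory.King1986
open Literature.MathematicalPhysics.QuantumFieldTheory.King1986.Torus

variable {d : ℕ} (N : ℕ) [NeZero N] (M : Fin d → ℕ) [hM : ∀ μ, NeZero (M μ)] (κ : Fin d)

/-! ## §3 Geometric sums over a block and the `val` bookkeeping of the slab differences -/

section Sums

omit [NeZero N] in
/-- No wrap-around for `s ≠ 0`: `val((N·val s + i) − i′) = N·val s + i − i′` in `ℤ∕(N·M_κ)` (`0 ≤ i, i′ < N`, `1 ≤ val s ≤ M_κ − 1`). [folklore] -/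
theorem val_slab_sub {s : ZMod (M κ)} (hs : s ≠ 0) (i i' : Fin N) :
    (((((N * s.val + (i : ℕ) : ℕ)) : ZMod (fine N M κ)) - ((i' : ℕ) : ZMod (fine N M κ))).val : ℝ)
      = (N : ℝ) * s.val + (i : ℕ) - (i' : ℕ) := by
  have hspos : 1 ≤ s.val := Nat.pos_of_ne_zero (fun h => hs ((ZMod.val_eq_zero s).mp h))
  have hsv : s.val < M κ := ZMod.val_lt s
  have hi : (i : ℕ) < N := i.isLt
  have hi' : (i' : ℕ) < N := i'.isLt
  have hle : (i' : ℕ) ≤ N * s.val + (i : ℕ) := by nlinarith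
  have hlt : N * s.val + (i : ℕ) - (i' : ℕ) < fine N M κ := by
    show N * s.val + (i : ℕ) - (i' : ℕ) < N * M κ
    have : N * s.val + (i : ℕ) < N * M κ := by nlinarith
    omega
  rw [← Nat.cast_sub hle, ZMod.val_cast_of_lt hlt, Nat.cast_sub hle]
  push_cast
  ring

omit [NeZero N] hM in
/-- `e^{−ω(N·val s + i − i′)} = e^{−ωN·val s}·(e^{−ωi}·e^{ωi′})`. [folklore] -/
theorem exp_slab_direct (ω : ℝ) (s : ZMod (M κ)) (i i' : Fin N) :
    Real.exp (-(ω * ((N : ℝ) * s.val + (i : ℕ) - (i' : ℕ))))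
      = Real.exp (-(ω * N * s.val)) * (Real.exp (-(ω * (i : ℕ))) * Real.exp (ω * (i' : ℕ))) := by
  rw [← Real.exp_add, ← Real.exp_add]; congr 1; ring

omit [NeZero N] hM in
/-- `e^{−ω(n − (N·val s + i − i′))} = e^{−ω(n − N·val s)}·(e^{ωi}·e^{−ωi′})`. [folklore] -/
theorem exp_slab_image (ω n : ℝ) (s : ZMod (M κ)) (i i' : Fin N) :
    Real.exp (-(ω * (n - ((N : ℝ) * s.val + (i : ℕ) - (i' : ℕ)))))
      = Real.exp (-(ω * (n - N * s.val))) * (Real.exp (ω * (i : ℕ)) * Real.exp (-(ω * (i' : ℕ)))) := by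
  rw [← Real.exp_add, ← Real.exp_add]; congr 1; ring

omit [NeZero N] in
/-- ★ **THE DOUBLE BLOCK SUM IN CLOSED FORM**: `(Σ_{i<N} e^{−ωi})(Σ_{i<N} e^{ωi}) = (sinh(Nω∕2)∕sinh(ω∕2))²` (`ω ≠ 0`; two geometric series).
[folklore] -/
theorem geomProd_eq_sinh_sq {ω : ℝ} (hω : ω ≠ 0) :
    (∑ i : Fin N, Real.exp (-(ω * (i : ℕ)))) * (∑ i : Fin N, Real.exp (ω * (i : ℕ)))
      = (Real.sinh (N * ω / 2) / Real.sinh (ω / 2)) ^ 2 := by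
  set E := Real.exp (ω / 2) with hE
  have hE0 : 0 < E := Real.exp_pos _
  have hE1 : E ≠ 1 := by
    rw [hE]; intro h
    have := Real.exp_injective (h.trans Real.exp_zero.symm)
    exact hω (by linarith)
  have hEsq1 : E ^ 2 ≠ 1 := by
    intro h
    have : E = 1 := by nlinarith [hE0]
    exact hE1 this
  have hEsq1' : (E ^ 2)⁻¹ ≠ 1 := by
    intro h; apply hEsq1; rw [← inv_inv (E ^ 2), h, inv_one]
  have hexp : ∀ i : ℕ, Real.exp (ω * (i : ℕ)) = (E ^ 2) ^ i := by
    intro i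
    rw [hE, ← Real.exp_nat_mul, ← Real.exp_nat_mul]
    congr 1; ring
  have hexpn : ∀ i : ℕ, Real.exp (-(ω * (i : ℕ))) = ((E ^ 2)⁻¹) ^ i := by
    intro i
    rw [inv_pow, ← hexp, Real.exp_neg]
  have hpos : ∑ i : Fin N, Real.exp (ω * (i : ℕ)) = ((E ^ 2) ^ N - 1) / (E ^ 2 - 1) := by
    rw [Fin.sum_univ_eq_sum_range (fun i => Real.exp (ω * (i : ℕ))) N]
    simp_rw [hexp]
    exact geom_sum_eq hEsq1 N
  have hneg : ∑ i : Fin N, Real.exp (-(ω * (i : ℕ))) = (((E ^ 2) ^ N)⁻¹ - 1) / ((E ^ 2)⁻¹ - 1) := by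
    rw [Fin.sum_univ_eq_sum_range (fun i => Real.exp (-(ω * (i : ℕ)))) N]
    simp_rw [hexpn]
    rw [geom_sum_eq hEsq1' N, inv_pow]
  have hs1 : Real.sinh (N * ω / 2) = (E ^ N - (E ^ N)⁻¹) / 2 := by
    rw [Real.sinh_eq, hE, ← Real.exp_nat_mul, ← Real.exp_neg]
    congr 2 <;> congr 1 <;> ring
  have hs2 : Real.sinh (ω / 2) = (E - E⁻¹) / 2 := by
    rw [Real.sinh_eq, hE, ← Real.exp_neg]
  rw [hpos, hneg, hs1, hs2]
  have hE2 : E ^ 2 - 1 ≠ 0 := sub_ne_zero.mpr hEsq1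
  have hEm : E - E⁻¹ ≠ 0 := by
    intro h
    have : E * E = 1 := by
      have h' : E = E⁻¹ := sub_eq_zero.mp h
      calc E * E = E * E⁻¹ := by rw [← h']
        _ = 1 := mul_inv_cancel₀ hE0.ne'
    apply hEsq1; nlinarith
  field_simp
  ring

end Sums

/-! ## §4 The block field's zero-momentum correlator is a pure cosh in block time with mass `N·ω₀` -/

section Cosh

variable {a m2 : ℝ}

/-- ★★★ **THE RG BLOCK FIELD's ZERO-MOMENTUM TIMESLICE CORRELATOR IS A PURE cosh IN BLOCK TIME WITH MASS `N·ω₀`.**  For King's block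
covariance `(Δ^{(K)})⁻¹` on the unit torus `Tor M` (`N ≥ 1` fine sites per block side, `a > 0`, `m² > 0`), every time axis `κ` and every block
separation `s ≠ 0`:
`Σ_{b : b_κ = s} (Δ^{(K)})⁻¹(b,0) = N^{−3}·P∕(2 sinh ω₀ (1 − e^{−ω₀·N·M_κ})) · (e^{−(N·ω₀)·val s} + e^{−(N·ω₀)·(M_κ − val s)})`,
`ω₀ = latticeMass(m²∕N²)`, `P = (Σ_{i<N} e^{−ω₀i})(Σ_{i<N} e^{ω₀i})` — the direct term and its image around the block period `M_κ`, decaying at the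
BLOCK MASS `N·ω₀ = 2N·arsinh(√m²∕(2N))` per block step: the Gaussian block-spin RG creates no new scale, and (PART Ϲ-c `kingGap_eta_rate`)
`0 ≤ √m² − N·ω₀ ≤ (√m²)³∕(24N²)` — its `N → ∞` limit is the `K = ∞` block field's exact gap `√m²`.
[cite: King1986, (2.13)–(2.14) p.653, (4.5) p.670, (4.44) p.675; MontvayMunster1994, §2.1.2 (2.49), §2.2.1 (2.74)–(2.82)] -/
theorem timeSlice_blockCov_eq_cosh (hN1 : 1 ≤ N) (ha : 0 < a) (hm : 0 < m2) {s : ZMod (M κ)} (hs : s ≠ 0) :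
    ∑ b : Tor M, (if b κ = s then (effLaplacian N M a ((N : ℝ) ^ 2) m2)⁻¹ b 0 else 0)
      = ((N : ℝ) ^ 3)⁻¹
          * (((∑ i : Fin N, Real.exp (-(latticeMass (m2 / (N : ℝ) ^ 2) * (i : ℕ))))
              * (∑ i : Fin N, Real.exp (latticeMass (m2 / (N : ℝ) ^ 2) * (i : ℕ))))
            / (2 * Real.sinh (latticeMass (m2 / (N : ℝ) ^ 2)) * (1 - Real.exp (-(latticeMass (m2 / (N : ℝ) ^ 2) * N * M κ)))))
          * (Real.exp (-(latticeMass (m2 / (N : ℝ) ^ 2) * N * s.val))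
              + Real.exp (-(latticeMass (m2 / (N : ℝ) ^ 2) * N * (M κ - s.val)))) := by
  set ω := latticeMass (m2 / (N : ℝ) ^ 2) with hω
  set D := 2 * Real.sinh ω * (1 - Real.exp (-(ω * N * M κ))) with hD
  rw [timeSlice_blockCov_eq_sum N M κ hN1 ha hm, if_neg hs, mul_zero, zero_add]
  have hn : ((fine N M κ : ℕ) : ℝ) = (N : ℝ) * M κ := by
    show (((N * M κ : ℕ)) : ℝ) = (N : ℝ) * M κ
    push_cast; ring
  -- each term of the double block average in exponential form
  have hterm : ∀ i i' : Fin N, cycleGreen (fine N M κ) (m2 / (N : ℝ) ^ 2)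
      ((((N * s.val + (i : ℕ) : ℕ)) : ZMod (fine N M κ)) - ((i' : ℕ) : ZMod (fine N M κ)))
      = (Real.exp (-(ω * N * s.val)) * (Real.exp (-(ω * (i : ℕ))) * Real.exp (ω * (i' : ℕ)))
          + Real.exp (-(ω * (N * M κ - N * s.val))) * (Real.exp (ω * (i : ℕ)) * Real.exp (-(ω * (i' : ℕ))))) / D := by
    intro i i'
    rw [cycleGreen_eq_exp, val_slab_sub N M κ hs, hn, ← hω, exp_slab_direct, exp_slab_image, hD]
    congr 2
    ring
  simp_rw [hterm]
  simp_rw [← Finset.sum_div, Finset.sum_add_distrib, ← Finset.mul_sum, ← Finset.sum_mul]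
  rw [mul_comm (∑ i : Fin N, Real.exp (ω * (i : ℕ))) (∑ i : Fin N, Real.exp (-(ω * (i : ℕ)))),
    show -(ω * ((N : ℝ) * (M κ : ℝ) - N * s.val)) = -(ω * N * (M κ - s.val)) by ring]
  ring

/-- ★★★ **THE SAME, WITH THE BLOCK SUMS IN CLOSED FORM**: for `s ≠ 0`,
`Σ_{b : b_κ = s} (Δ^{(K)})⁻¹(b,0) = N^{−3}·(sinh(Nω₀∕2)∕sinh(ω₀∕2))² ∕ (2 sinh ω₀ (1 − e^{−ω₀NM_κ})) · (e^{−Nω₀·val s} + e^{−Nω₀(M_κ − val s)})` — a pure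
`cosh` in block time centred at `M_κ∕2` with mass `N·ω₀ = 2N·arsinh(√m²∕(2N))`. [cite: King1986, (2.13)–(2.14) p.653, (4.5) p.670; MontvayMunster1994, §2.1.2 (2.49), §2.2.1 (2.74)–(2.82)] -/
theorem timeSlice_blockCov_eq_cosh' (hN1 : 1 ≤ N) (ha : 0 < a) (hm : 0 < m2) {s : ZMod (M κ)} (hs : s ≠ 0) :
    ∑ b : Tor M, (if b κ = s then (effLaplacian N M a ((N : ℝ) ^ 2) m2)⁻¹ b 0 else 0)
      = ((N : ℝ) ^ 3)⁻¹
          * ((Real.sinh (N * latticeMass (m2 / (N : ℝ) ^ 2) / 2) / Real.sinh (latticeMass (m2 / (N : ℝ) ^ 2) / 2)) ^ 2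
            / (2 * Real.sinh (latticeMass (m2 / (N : ℝ) ^ 2)) * (1 - Real.exp (-(latticeMass (m2 / (N : ℝ) ^ 2) * N * M κ)))))
          * (Real.exp (-(latticeMass (m2 / (N : ℝ) ^ 2) * N * s.val))
              + Real.exp (-(latticeMass (m2 / (N : ℝ) ^ 2) * N * (M κ - s.val)))) := by
  have hN : (0 : ℝ) < (N : ℝ) ^ 2 := by have := NeZero.ne N; positivity
  rw [timeSlice_blockCov_eq_cosh N M κ hN1 ha hm hs, geomProd_eq_sinh_sq N (latticeMass_pos (div_pos hm hN)).ne']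

/-- ★★ The block field's zero-momentum timeslice correlator is STRICTLY POSITIVE at every block separation `s ≠ 0` (Griffiths I for King's RG
block-field law, read on timeslices). [folklore] -/
theorem timeSlice_blockCov_pos (hN1 : 1 ≤ N) (ha : 0 < a) (hm : 0 < m2) {s : ZMod (M κ)} (hs : s ≠ 0) :
    0 < ∑ b : Tor M, (if b κ = s then (effLaplacian N M a ((N : ℝ) ^ 2) m2)⁻¹ b 0 else 0) := by
  have hN : (0 : ℝ) < (N : ℝ) ^ 2 := by have := NeZero.ne N; positivity
  rw [timeSlice_blockCov_eq_sum N M κ hN1 ha hm, if_neg hs, mul_zero, zero_add]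
  refine mul_pos (by have := NeZero.ne N; positivity) (Finset.sum_pos (fun i _ => Finset.sum_pos (fun i' _ => ?_) Finset.univ_nonempty)
    Finset.univ_nonempty)
  exact cycleGreen_pos (fine N M κ) (div_pos hm hN) _

end Cosh

end Summit.QuantumFields.YangMills.BalabanUVNodes.N15KingModelRung.TorusSpectral
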